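import Summits.QuantumFields.YangMills.Theorems.BalabanUVNodesN20ClassLawConditionalHybridBound

/-!
# BalabanUVNodes ∕ N20·N19′·N21 — THE CONDITIONAL HYBRID BOUND FOR TWO ARBITRARY LAWS, TOWER-FREE (FILE V): the canonical tower of MARGINALS of a weight function on the
# large-field configurations `S ⊆ range n` (`M_i(S) = Σ_{R ⊆ range n, R ∩ range i = S} W(R)`) is consistent, starts at the total and ends at `W`; hence FILE T's chain rule reads,
# for ANY two non-negative `W_A, W_B`: `Σ_S |W_A − W_B| ≤ |Σ W_A − Σ W_B| + 2·Σ_{i<n} Σ_{S ⊆ range i} |M_A^{i+1}(S∪{i})·M_B^i(S) − M_B^{i+1}(S∪{i})·M_A^i(S)| ∕ M_B^i(S)` — no tower to supply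

Cell `pub-ymgap` (HUMAN RULING D-0062 Track A; work-bound push D-0149, director-ym №197), width seat `pub-ymgap-dag-n20-w1` (gen 7) on node N20 = NE7b; key item of this
seat's payload K3⁷ `SpineGivenEndpointR13SepCoPH` = stmt-QuantumFields-20544 (ASIDE; lineage of K3⁸ `SpineGivenEndpointR13SepCoPHV` = stmt-QuantumFields-27366, skeleton v6
b4e55110ab73e679 UNTOUCHED; `--kind proof --supports 20544 --as helper`, MIS-KEY rule R463 (4)(a)); COUNT-NEUTRAL.  Bus: CLAIM-26 ∕ INTENT-31.
THEOREMS ONLY (0 def ∕ instance ∕ notation ∕ sorry); imports this seat's FILE T `…N20ClassLawConditionalHybridBound` (p639220) ONLY.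

WHY.  FILE T's `l1_le_of_avgCondGapTower` takes the two runs' TOWERS OF MARGINALS as data (`P_i` on `(range i).powerset`, consistency as a hypothesis) — the right shape for a key
tower read off the record, but it leaves the reader to check that such towers EXIST for any pair of laws (A6: are the hypotheses inhabited beyond the caricature?).  They always do:
the marginal of a weight function `W` on the configurations of `n` blocks onto the first `i` blocks is the fibre sum `M_i(S) = Σ_{R ⊆ range n, R ∩ range i = S} W(R)` (spelled
inline), and §1 proves the three tower axioms for it — ★ `marginal_consistent` (`M_i(S) = M_{i+1}(S) + M_{i+1}(S ∪ {i})` for `S ⊆ range i`, `i < n`: split the fibre by `i ∈ R`;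
`range (i+1) = insert i (range i)`, `Finset.inter_insert_of_mem ∕ _of_notMem`), `marginal_top` (`M_n = W` on `(range n).powerset`), `marginal_zero` (`M_0(∅) = Σ W`), `marginal_nonneg`.
§2 is FILE T's chain rule with the towers ELIMINATED: ★★★ `l1_le_of_avgCondGap_marginals` — for ANY non-negative `W_A, W_B` on `(range n).powerset`,
`Σ_{S ⊆ range n} |W_A(S) − W_B(S)| ≤ |Σ W_A − Σ W_B| + 2·Σ_{i<n} Σ_{S ⊆ range i} |M_A^{i+1}(S∪{i})·M_B^i(S) − M_B^{i+1}(S∪{i})·M_A^i(S)| ∕ M_B^i(S)`, and its uniform form ★★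
`l1_le_two_mul_sum_of_condDiscrepancy_marginals` (two probability weights whose block-`i` conditionals given every earlier configuration differ by `≤ ε_i` in the division-free
sense ⇒ `ℓ¹ ≤ 2·Σ_{i<n} ε_i`).  So the located letter of FILE T («per-block CONDITIONAL two-run discrepancies, summable») is a statement about the two class laws ALONE.
HONEST FRAMING.  [folklore] finite-sum bookkeeping (marginals of a law on a finite product of two-point spaces) on hypothesis SHAPES; nothing read at the record; proves NO estimate
of Bałaban's; refutes NO registered stub; nothing of Bałaban's asserted or instantiated.  NE7 ∕ NE7b ∕ NE7c NOT PRINTED for `d = 4`, NOT proved; N19 ∕ N20 ∕ N21 NOT discharged; K3⁸ ∕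
K3⁷ OPEN; counts unmoved (typed 28∕28 · discharged 5∕27); no count claim.  One finite `𝕋⁴_{L^K}` programme at fixed `ε = L^{−K}`, Bałaban AS PRINTED; the YM mass gap (Clay) is NOT
proved by any of this — R4 closes the conditional finite-𝕋⁴ rung `BalabanLadder.UV` only; NOT ℝ⁴, NOT OS.  No decl carries a cite tag.
-/

noncomputable section

open Finset
open Summit.QuantumFields.YangMills.BalabanUVNodes.N20ClassLawConditionalHybridBound

namespace Summit.QuantumFields.YangMills.BalabanUVNodes.N20ClassLawConditionalHybridBoundMarginals

/-! ## §1 The canonical tower of marginals of a law on `(range n).powerset` -/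

section Marginals

variable (n : ℕ) (W : Finset ℕ → ℝ)

/-- The fibre `{R : R ∩ range i = S}` splits by `i ∈ R` into the two fibres of level `i + 1` over `S ∪ {i}` and over `S` (`S ⊆ range i`): the part with `i ∈ R`. [bookkeeping] -/
theorem inter_range_eq_and_mem_iff {i : ℕ} {S R : Finset ℕ} (hS : S ⊆ Finset.range i) :
    (R ∩ Finset.range i = S ∧ i ∈ R) ↔ R ∩ Finset.range (i + 1) = insert i S := by
  have hiS : i ∉ S := fun h => Finset.notMem_range_self (hS h)
  rw [Finset.range_add_one]
  constructor
  · rintro ⟨h, hi⟩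
    rw [Finset.inter_insert_of_mem hi, h]
  · intro h
    by_cases hi : i ∈ R
    · rw [Finset.inter_insert_of_mem hi] at h
      refine ⟨?_, hi⟩
      have hi' : i ∉ R ∩ Finset.range i := fun h' => Finset.notMem_range_self (Finset.mem_inter.1 h').2
      rw [← Finset.erase_insert hi', h, Finset.erase_insert hiS]
    · rw [Finset.inter_insert_of_notMem hi] at h
      exact absurd (h ▸ Finset.mem_insert_self i S : i ∈ R ∩ Finset.range i) fun h' => Finset.notMem_range_self (Finset.mem_inter.1 h').2

/-- … and the part with `i ∉ R`. [bookkeeping] -/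
theorem inter_range_eq_and_notMem_iff {i : ℕ} {S R : Finset ℕ} (hS : S ⊆ Finset.range i) :
    (R ∩ Finset.range i = S ∧ i ∉ R) ↔ R ∩ Finset.range (i + 1) = S := by
  rw [Finset.range_add_one]
  constructor
  · rintro ⟨h, hi⟩
    rw [Finset.inter_insert_of_notMem hi, h]
  · intro h
    by_cases hi : i ∈ R
    · rw [Finset.inter_insert_of_mem hi] at h
      exact absurd (hS (h ▸ Finset.mem_insert_self i (R ∩ Finset.range i) : i ∈ S)) Finset.notMem_range_self
    · rw [Finset.inter_insert_of_notMem hi] at h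
      exact ⟨h, hi⟩

/-- ★ **THE MARGINALS ARE CONSISTENT** [folklore]: for `i < n` and `S ⊆ range i`,
`Σ_{R ⊆ range n, R ∩ range i = S} W(R) = Σ_{R ⊆ range n, R ∩ range (i+1) = S} W(R) + Σ_{R ⊆ range n, R ∩ range (i+1) = S ∪ {i}} W(R)`. -/
theorem marginal_consistent {i : ℕ} {S : Finset ℕ} (hS : S ⊆ Finset.range i) :
    ∑ R ∈ (Finset.range n).powerset.filter (fun R => R ∩ Finset.range i = S), W R =
      ∑ R ∈ (Finset.range n).powerset.filter (fun R => R ∩ Finset.range (i + 1) = S), W R +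
        ∑ R ∈ (Finset.range n).powerset.filter (fun R => R ∩ Finset.range (i + 1) = insert i S), W R := by
  rw [← Finset.sum_filter_add_sum_filter_not ((Finset.range n).powerset.filter (fun R => R ∩ Finset.range i = S)) (fun R => i ∉ R), Finset.filter_filter,
    Finset.filter_filter]
  congr 1
  · exact Finset.sum_congr (Finset.filter_congr fun R _ => inter_range_eq_and_notMem_iff hS) fun _ _ => rfl
  · exact Finset.sum_congr (Finset.filter_congr fun R _ => by rw [not_not]; exact inter_range_eq_and_mem_iff hS) fun _ _ => rfl

/-- The TOP marginal is the law itself: for `S ⊆ range n`, `Σ_{R ⊆ range n, R ∩ range n = S} W(R) = W(S)`. [bookkeeping] -/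
theorem marginal_top {S : Finset ℕ} (hS : S ⊆ Finset.range n) :
    ∑ R ∈ (Finset.range n).powerset.filter (fun R => R ∩ Finset.range n = S), W R = W S := by
  have e : (Finset.range n).powerset.filter (fun R => R ∩ Finset.range n = S) = {S} := by
    ext R
    simp only [Finset.mem_filter, Finset.mem_powerset, Finset.mem_singleton]
    constructor
    · rintro ⟨hR, h⟩; rwa [Finset.inter_eq_left.2 hR] at h
    · rintro rfl; exact ⟨hS, Finset.inter_eq_left.2 hS⟩
  rw [e, Finset.sum_singleton]

/-- The BOTTOM marginal is the total: `Σ_{R ⊆ range n, R ∩ range 0 = ∅} W(R) = Σ_{R ⊆ range n} W(R)`. [bookkeeping] -/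
theorem marginal_zero : ∑ R ∈ (Finset.range n).powerset.filter (fun R => R ∩ Finset.range 0 = ∅), W R = ∑ R ∈ (Finset.range n).powerset, W R := by
  rw [Finset.filter_true_of_mem fun R _ => by rw [Finset.range_zero, Finset.inter_empty]]

/-- Marginals of a non-negative law are non-negative. [bookkeeping] -/
theorem marginal_nonneg (hW : ∀ R ⊆ Finset.range n, 0 ≤ W R) (i : ℕ) (S : Finset ℕ) :
    0 ≤ ∑ R ∈ (Finset.range n).powerset.filter (fun R => R ∩ Finset.range i = S), W R :=
  Finset.sum_nonneg fun R hR => hW R (Finset.mem_powerset.1 (Finset.mem_filter.1 hR).1)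

end Marginals

/-! ## §2 FILE T's chain rule with the towers eliminated -/

section TowerFree

variable (n : ℕ) (WA WB : Finset ℕ → ℝ)

/-- ★★★ **THE CONDITIONAL HYBRID BOUND FOR TWO ARBITRARY LAWS, MASS-WEIGHTED, TOWER-FREE** [folklore]: for non-negative `W_A, W_B` on the configurations `S ⊆ range n`, with
marginals `M_X^i(S) = Σ_{R ⊆ range n, R ∩ range i = S} W_X(R)`:
`Σ_{S⊆range n} |W_A(S) − W_B(S)| ≤ |Σ W_A − Σ W_B| + 2·Σ_{i<n} Σ_{S⊆range i} |M_A^{i+1}(S∪{i})·M_B^i(S) − M_B^{i+1}(S∪{i})·M_A^i(S)| ∕ M_B^i(S)` — FILE T `l1_le_of_avgCondGapTower` at the canonical towers. -/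
theorem l1_le_of_avgCondGap_marginals (hA : ∀ R ⊆ Finset.range n, 0 ≤ WA R) (hB : ∀ R ⊆ Finset.range n, 0 ≤ WB R) :
    ∑ S ∈ (Finset.range n).powerset, |WA S - WB S| ≤ |∑ R ∈ (Finset.range n).powerset, WA R - ∑ R ∈ (Finset.range n).powerset, WB R| +
      2 * ∑ i ∈ Finset.range n, ∑ S ∈ (Finset.range i).powerset,
        |(∑ R ∈ (Finset.range n).powerset.filter (fun R => R ∩ Finset.range (i + 1) = insert i S), WA R) *
            (∑ R ∈ (Finset.range n).powerset.filter (fun R => R ∩ Finset.range i = S), WB R) -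
          (∑ R ∈ (Finset.range n).powerset.filter (fun R => R ∩ Finset.range (i + 1) = insert i S), WB R) *
            (∑ R ∈ (Finset.range n).powerset.filter (fun R => R ∩ Finset.range i = S), WA R)| /
          ∑ R ∈ (Finset.range n).powerset.filter (fun R => R ∩ Finset.range i = S), WB R := by
  have h := l1_le_of_avgCondGapTower (fun i S => ∑ R ∈ (Finset.range n).powerset.filter (fun R => R ∩ Finset.range i = S), WA R)
    (fun i S => ∑ R ∈ (Finset.range n).powerset.filter (fun R => R ∩ Finset.range i = S), WB R) n
    (fun i _ S _ => marginal_nonneg n WA hA i S) (fun i _ S _ => marginal_nonneg n WB hB i S)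
    (fun i _ S hS => marginal_consistent n WA hS) (fun i _ S hS => marginal_consistent n WB hS)
  simp only [marginal_zero] at h
  have eA : ∑ S ∈ (Finset.range n).powerset, |WA S - WB S| =
      ∑ S ∈ (Finset.range n).powerset, |(∑ R ∈ (Finset.range n).powerset.filter (fun R => R ∩ Finset.range n = S), WA R) -
        ∑ R ∈ (Finset.range n).powerset.filter (fun R => R ∩ Finset.range n = S), WB R| :=
    Finset.sum_congr rfl fun S hS => by rw [marginal_top n WA (Finset.mem_powerset.1 hS), marginal_top n WB (Finset.mem_powerset.1 hS)]
  rw [eA]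
  exact h

/-- ★★ **UNIFORM FORM, TOWER-FREE** [folklore]: two PROBABILITY weights `W_A, W_B ≥ 0` (totals `1`) on the configurations of `n` blocks whose block-`i` CONDITIONAL probabilities
given every earlier configuration differ by at most `ε_i ≥ 0` — division-free on the marginals: `|M_A^{i+1}(S∪{i})·M_B^i(S) − M_B^{i+1}(S∪{i})·M_A^i(S)| ≤ ε_i·M_A^i(S)·M_B^i(S)`
for `S ⊆ range i` — are `2·Σ_{i<n} ε_i`-close in ℓ¹.  NO independence; the hypothesis mentions only the two laws. -/
theorem l1_le_two_mul_sum_of_condDiscrepancy_marginals (ε : ℕ → ℝ) (hε : ∀ i < n, 0 ≤ ε i)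
    (hA : ∀ R ⊆ Finset.range n, 0 ≤ WA R) (hB : ∀ R ⊆ Finset.range n, 0 ≤ WB R)
    (hA1 : ∑ R ∈ (Finset.range n).powerset, WA R = 1) (hB1 : ∑ R ∈ (Finset.range n).powerset, WB R = 1)
    (hcond : ∀ i < n, ∀ S ⊆ Finset.range i,
      |(∑ R ∈ (Finset.range n).powerset.filter (fun R => R ∩ Finset.range (i + 1) = insert i S), WA R) *
          (∑ R ∈ (Finset.range n).powerset.filter (fun R => R ∩ Finset.range i = S), WB R) -
        (∑ R ∈ (Finset.range n).powerset.filter (fun R => R ∩ Finset.range (i + 1) = insert i S), WB R) *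
          (∑ R ∈ (Finset.range n).powerset.filter (fun R => R ∩ Finset.range i = S), WA R)| ≤
      ε i * ((∑ R ∈ (Finset.range n).powerset.filter (fun R => R ∩ Finset.range i = S), WA R) *
        ∑ R ∈ (Finset.range n).powerset.filter (fun R => R ∩ Finset.range i = S), WB R)) :
    ∑ S ∈ (Finset.range n).powerset, |WA S - WB S| ≤ 2 * ∑ i ∈ Finset.range n, ε i := by
  have h := l1_le_two_mul_sum_condDiscrepancy (fun i S => ∑ R ∈ (Finset.range n).powerset.filter (fun R => R ∩ Finset.range i = S), WA R)
    (fun i S => ∑ R ∈ (Finset.range n).powerset.filter (fun R => R ∩ Finset.range i = S), WB R) ε n hε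
    (fun i _ S _ => marginal_nonneg n WA hA i S) (fun i _ S _ => marginal_nonneg n WB hB i S)
    (by simp only [marginal_zero]; exact hA1) (by simp only [marginal_zero]; exact hB1)
    (fun i _ S hS => marginal_consistent n WA hS) (fun i _ S hS => marginal_consistent n WB hS) hcond
  have eA : ∑ S ∈ (Finset.range n).powerset, |WA S - WB S| =
      ∑ S ∈ (Finset.range n).powerset, |(∑ R ∈ (Finset.range n).powerset.filter (fun R => R ∩ Finset.range n = S), WA R) -
        ∑ R ∈ (Finset.range n).powerset.filter (fun R => R ∩ Finset.range n = S), WB R| :=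
    Finset.sum_congr rfl fun S hS => by rw [marginal_top n WA (Finset.mem_powerset.1 hS), marginal_top n WB (Finset.mem_powerset.1 hS)]
  rw [eA]
  exact h

/-- THE GROWING-WINDOW INSTANCE OF THE LETTER [bookkeeping]: POLYNOMIALLY many blocks (`n_K ≤ C·(K+1)^m` — e.g. a window whose width grows like `log K` or any power, cf. the
over-age budget `j⋆(K) = L·R_w + c₀ + κ₁ log K` of crux card `window-key-core` ed. 4) with conditional discrepancies contracting geometrically in the cutoff (`0 ≤ ε_{K,i} ≤ ρ·θ^K`,
`0 ≤ θ < 1`) still give a SUMMABLE tower letter `Σ_K Σ_{i<n_K} ε_{K,i} < ∞` (FILE T's bounded-window instance is `m = 0`). -/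
theorem summable_sum_condDiscrepancy_of_polyBlocks_of_geometric (nb : ℕ → ℕ) (ε : ℕ → ℕ → ℝ) {C ρ θ : ℝ} {m : ℕ} (hρ : 0 ≤ ρ) (hθ0 : 0 ≤ θ) (hθ1 : θ < 1)
    (hn : ∀ K, (nb K : ℝ) ≤ C * ((K : ℝ) + 1) ^ m) (hε0 : ∀ K, ∀ i < nb K, 0 ≤ ε K i) (hε : ∀ K, ∀ i < nb K, ε K i ≤ ρ * θ ^ K) :
    Summable fun K => ∑ i ∈ Finset.range (nb K), ε K i := by
  -- `Σ_K (K+1)^m θ^K < ∞`: shift the index in Mathlib's `summable_pow_mul_geometric_of_norm_lt_one`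
  have hgeo : Summable fun K : ℕ => ((K : ℝ) + 1) ^ m * θ ^ K := by
    have h := (summable_pow_mul_geometric_of_norm_lt_one m (show ‖θ‖ < 1 by rwa [Real.norm_eq_abs, abs_of_nonneg hθ0])).comp_injective
      (fun a b h => Nat.succ_injective h : Function.Injective Nat.succ)
    rcases hθ0.eq_or_lt with hz | hpos
    · refine summable_of_ne_finset_zero (s := {0}) fun K hK => ?_
      rw [Finset.mem_singleton] at hK
      rw [← hz, zero_pow hK, mul_zero]
    · refine (h.mul_left θ⁻¹).congr fun K => ?_
      simp only [Function.comp, Nat.succ_eq_add_one, Nat.cast_add, Nat.cast_one, pow_succ]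
      field_simp
  refine Summable.of_nonneg_of_le (fun K => Finset.sum_nonneg fun i hi => hε0 K i (Finset.mem_range.1 hi)) (fun K => ?_) (hgeo.mul_left (C * ρ))
  calc ∑ i ∈ Finset.range (nb K), ε K i ≤ ∑ _i ∈ Finset.range (nb K), ρ * θ ^ K := Finset.sum_le_sum fun i hi => hε K i (Finset.mem_range.1 hi)
    _ = nb K * (ρ * θ ^ K) := by rw [Finset.sum_const, Finset.card_range, nsmul_eq_mul]
    _ ≤ C * ((K : ℝ) + 1) ^ m * (ρ * θ ^ K) := mul_le_mul_of_nonneg_right (hn K) (mul_nonneg hρ (pow_nonneg hθ0 _))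
    _ = C * ρ * (((K : ℝ) + 1) ^ m * θ ^ K) := by ring

end TowerFree

end Summit.QuantumFields.YangMills.BalabanUVNodes.N20ClassLawConditionalHybridBoundMarginals

end
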